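import Literature.NumberTheory.EllipticCurves.IwasawaEulerCharDualityProofs
import Literature.NumberTheory.EllipticCurves.IwasawaAlgebraProofs
import HarnessLib

/-!
# `#S[p] = p^{λ(X)}` for a divisible group `S` whose Pontryagin dual `X` is a finitely generated
# torsion `Λ`-module with `μ = 0` (the group theory of Greenberg–Vatsal 2000, (7) ⇒ p. 8
# "`λ_{E,Σ₀} = dim_{𝔽_p} Sel^{Σ₀}_E(ℚ_∞)_p[p]`")

HONEST FRAMING (BSD rank-`≤ 1` residual cell `b2b-bsdres`, home
`run/shared/lean/b2b/bsd-rank1-residual/`, unit `b2b-bsdres-eisenstein-p2`, class X2; research route,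
no claim beyond stated classes): the cell deletes the COMBINATION-SHAPED residual classes of the
rank-`≤ 1` BSD formula from PUBLISHED theorems only and TYPES the construction-shaped ones; this is
not "finishing BSD". This file is PURE ALGEBRA, theorems only (no definition, no named fact, nothing
asserted): the step of Greenberg–Vatsal's proof of Thm. (1.4) (Invent. Math. 142 (2000), §1 p. 8 and
§2 p. 25) that turns "`Sel^{Σ₀}_E(ℚ_∞)_p` is divisible and `Λ`-cotorsion with `μ = 0`" into
"`Sel^{Σ₀}_E(ℚ_∞)_p ≅ (ℚ_p/ℤ_p)^{λ}` and therefore `λ^{alg}_{E,Σ₀} = dim_{𝔽_p}(Sel^{Σ₀}_E(ℚ_∞)_p[p])`",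
for an ABSTRACT abelian group `S` with a Pontryagin dual `X ≅ Hom(S, ℚ/ℤ)`:

* `characterModule_torsionBy_eq_zero_of_divisible`: if `S = pS` then `Hom(S, ℚ/ℤ)[p] = 0`;
* `finite_characterModule_torsionBy_of_addEquiv`: if `X ≅ Hom(S, ℚ/ℤ)` is a finitely generated
  `ℤ_p`-module then `Hom(S[p], ℚ/ℤ)` and `S[p]` are finite (restriction `X/pX ↠ Hom(S[p], ℚ/ℤ)`);
* **`natCard_torsionBy_eq_pow_finrank_of_divisible`**: if moreover `S = pS` then
  `#S[p] = p ^ rank_{ℤ_p} X` (`#S[p] = #Hom(S[p], ℚ/ℤ) = #(X/pX) = p^{rank X}·#X[p]` and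
  `X[p] ≅ Hom(S, ℚ/ℤ)[p] = 0`; the tree's `ZpCorank.natCard_modN_eq`,
  `natCard_modN_characterModule_le`, `natCard_characterModule_torsionBy_le`);
* `lambdaInvariant_eq_finrank`: for a finitely generated torsion `Λ = ℤ_p⟦T⟧`-module `X` with
  `μ(X) = 0`, `λ(X) = dim_{ℚ_p}(X ⊗ ℚ_p) = rank_{ℤ_p} X` (`X` is then finitely generated over `ℤ_p`,
  `muInvariant_eq_zero_iff_finite`);
* **`natCard_torsionBy_eq_pow_lambdaInvariant_of_divisible`**: the two combined — for `S = pS`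
  with a Pontryagin dual `X ≅ Hom(S, ℚ/ℤ)` (as groups) that is a finitely generated torsion
  `Λ`-module with `μ(X) = 0`: `S[p]` is finite and `#S[p] = p ^ λ(X)`.

Consumers: `X2/CongruentLambdaShiftDerived.lean` (with `S = Sel^{Σ₀}_E(ℚ_∞)_p`, GV's non-primitive
Selmer group, `Literature/…/GreenbergVatsal2000/NonPrimitiveSelmerGroup.lean`), where divisibility
is GV Prop. (2.8)/p. 8 and `X` f.g. torsion with `μ = 0`, `λ(X) = λ_E + Σ δ` is GV (7).

References: R. Greenberg, V. Vatsal, Invent. Math. 142 (2000) 17–63, §1 p. 8 ("In particular,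
`Sel^{Σ₀}_E(ℚ_∞)_p ≅ (ℚ_p/ℤ_p)^{λ^{alg}_{E,Σ₀}}`, and therefore we find that
`λ^{alg}_{E,Σ₀} = dim_{𝔽_p}(Sel^{Σ₀}_E(ℚ_∞)_p[p])`"), §2 p. 25 (proof of Prop. (2.8): "its
`O`-torsion submodule is `0`, and so `S^{Σ₀}_A(ℚ_∞)` is `O`-divisible. That is,
`S^{Σ₀}_A(ℚ_∞) ≅ (F_p/O)^λ`"); R. Greenberg, LNM 1716 (1999), §1 p. 60 (Pontryagin dual `X`).
-/

noncomputable section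

open scoped Classical AddSubgroup TensorProduct

universe u

namespace Summit.BirchSwinnertonDyer.Rank1Residual.X2.NonPrimitiveSelmerTorsionCard

open Literature.NumberTheory.EllipticCurves Literature.NumberTheory.EllipticCurves.ZpCorank
  Literature.NumberTheory.EllipticCurves.IwasawaAlgebra

/-! ## §1. Divisible groups: `Hom(S, ℚ/ℤ)[p] = 0`, `S/pS = 0` -/

section Divisible

variable (p : ℕ) {S : Type*} [AddCommGroup S]

/-- A `p`-torsion character of a `p`-divisible group vanishes: `χ(s) = χ(p t) = (p χ)(t) = 0`.
[folklore] -/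
theorem characterModule_torsionBy_eq_zero_of_divisible (hdiv : ∀ s : S, ∃ t : S, p • t = s)
    (χ : (CharacterModule S)[(p : ℤ)]) : χ = 0 := by
  apply Subtype.ext
  refine AddMonoidHom.ext fun s ↦ ?_
  obtain ⟨t, rfl⟩ := hdiv s
  have h := DFunLike.congr_fun (congrArg Subtype.val (AddSubgroup.torsionBy.nsmul χ)) t
  simp only [AddSubgroupClass.coe_nsmul, ZeroMemClass.coe_zero] at h
  change (χ : CharacterModule S) (p • t) = 0
  rw [map_nsmul]
  exact h

/-- For a `p`-divisible group, `S/pS = 0`. [folklore] -/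
theorem modN_eq_zero_of_divisible (hdiv : ∀ s : S, ∃ t : S, p • t = s) (q : ModN S p) : q = 0 := by
  obtain ⟨s, rfl⟩ := Submodule.mkQ_surjective _ q
  obtain ⟨t, rfl⟩ := hdiv s
  change ModN.mkQ p (p • t) = 0
  rw [modN_mkQ_eq_zero_iff]
  exact ⟨t, by rw [LinearMap.lsmul_apply, natCast_zsmul]⟩

end Divisible

/-! ## §2. `#S[p] = p ^ rank_{ℤ_p} X` for `X ≅ Hom(S, ℚ/ℤ)` finitely generated over `ℤ_p`, `S = pS` -/

section Count

variable (p : ℕ) [hp : Fact p.Prime] {S : Type*} [AddCommGroup S]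
  {N : Type*} [AddCommGroup N] [Module ℤ_[p] N] [Module.Finite ℤ_[p] N]

/-- **`Hom(S[p], ℚ/ℤ)` is finite** when `Hom(S, ℚ/ℤ) ≅ N` is a finitely generated `ℤ_p`-module:
restriction of characters `Hom(S, ℚ/ℤ)/p → Hom(S[p], ℚ/ℤ)` is onto (characters of a subgroup
extend, `ℚ/ℤ` being injective) and `N/pN` is finite. [folklore] -/
theorem finite_characterModule_torsionBy_of_addEquiv (Ψ : N ≃+ CharacterModule S) :
    Finite (CharacterModule (S[(p : ℤ)])) := by
  obtain ⟨hNmod, -⟩ := natCard_modN_le p N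
  haveI := hNmod
  haveI : Finite (ModN (CharacterModule S) p) := Finite.of_equiv _ (modNEquiv Ψ p).toEquiv
  -- the restriction `r : Hom(S, ℚ/ℤ)/p → Hom(S[p], ℚ/ℤ)`
  let r : ModN (CharacterModule S) p →+ CharacterModule (S[(p : ℤ)]) :=
    ModN.liftEquiv.symm
      ⟨(CharacterModule.dual ((S[(p : ℤ)]).subtype.toIntLinearMap)).toAddMonoidHom, fun χ ↦ by
        refine AddMonoidHom.ext fun b ↦ ?_
        show p • χ (b : S) = 0
        rw [← map_nsmul, ← AddSubgroupClass.coe_nsmul, AddSubgroup.torsionBy.nsmul b,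
          ZeroMemClass.coe_zero, map_zero]⟩
  have hr : ∀ (χ : CharacterModule S) (b : S[(p : ℤ)]), r (ModN.mkQ p χ) b = χ b := fun _ _ ↦ rfl
  refine Finite.of_surjective r fun ψ ↦ ?_
  obtain ⟨χ, hχ⟩ := CharacterModule.dual_surjective_of_injective
    ((S[(p : ℤ)]).subtype.toIntLinearMap) (fun a b h ↦ Subtype.ext h) ψ
  refine ⟨ModN.mkQ p χ, CharacterModule.ext (A := S[(p : ℤ)]) fun b ↦ ?_⟩
  rw [hr, ← hχ]
  rfl

/-- **`S[p]` is finite** when `Hom(S, ℚ/ℤ)` is (as a group) a finitely generated `ℤ_p`-module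
(an abelian group with finitely many characters is finite). [folklore] -/
theorem finite_torsionBy_of_addEquiv (Ψ : N ≃+ CharacterModule S) : Finite (S[(p : ℤ)]) := by
  haveI := finite_characterModule_torsionBy_of_addEquiv p Ψ
  exact PontryaginCard.finite_of_finite_characterModule _

/-- **`#S[p] = p ^ rank_{ℤ_p} X`** for a `p`-DIVISIBLE group `S` whose character group
`Hom(S, ℚ/ℤ) ≅ N` is a finitely generated `ℤ_p`-module:
`#S[p] = #Hom(S[p], ℚ/ℤ) = #(N/pN) = p^{rank N} · #N[p]` (`ZpCorank.natCard_modN_eq`) and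
`N[p] ≅ Hom(S, ℚ/ℤ)[p] = 0` (`characterModule_torsionBy_eq_zero_of_divisible`). This is
"`S ≅ (ℚ_p/ℤ_p)^{rank}` as a group, hence `rank = dim_{𝔽_p} S[p]`" (GV 2000 p. 8, p. 25) read through
the dual. [folklore] -/
theorem natCard_torsionBy_eq_pow_finrank_of_divisible (hdiv : ∀ s : S, ∃ t : S, p • t = s)
    (Ψ : N ≃+ CharacterModule S) :
    Nat.card (S[(p : ℤ)]) = p ^ Module.finrank ℤ_[p] N := by
  haveI := finite_characterModule_torsionBy_of_addEquiv p Ψ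
  haveI : Finite (S[(p : ℤ)]) := finite_torsionBy_of_addEquiv p Ψ
  obtain ⟨hNmod, -⟩ := natCard_modN_le p N
  haveI := hNmod
  haveI : Finite (ModN (CharacterModule S) p) := Finite.of_equiv _ (modNEquiv Ψ p).toEquiv
  letI : Module (ZMod p) (S[(p : ℤ)]) := AddSubgroup.torsionBy.zmodModule
  -- `#Hom(S[p], ℚ/ℤ) = #(Hom(S, ℚ/ℤ)/p)`
  have h1 : Nat.card (CharacterModule (S[(p : ℤ)])) = Nat.card (ModN (CharacterModule S) p) :=
    le_antisymm (natCard_characterModule_torsionBy_le p S) (natCard_modN_characterModule_le p S)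
  -- `N[p] ≅ Hom(S, ℚ/ℤ)[p] = 0`
  have h2 : Nat.card (N[(p : ℤ)]) = 1 := by
    rw [Nat.card_congr (torsionByEquiv Ψ p).toEquiv]
    haveI : Subsingleton ((CharacterModule S)[(p : ℤ)]) :=
      ⟨fun a b ↦ by
        rw [characterModule_torsionBy_eq_zero_of_divisible p hdiv a,
          characterModule_torsionBy_eq_zero_of_divisible p hdiv b]⟩
    exact Nat.card_of_subsingleton (0 : (CharacterModule S)[(p : ℤ)])
  rw [← ZpCorank.natCard_characterModule p (S[(p : ℤ)]), h1,
    ← Nat.card_congr (modNEquiv Ψ p).toEquiv, natCard_modN_eq p N, h2, mul_one]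

end Count

/-! ## §3. `λ(X) = rank_{ℤ_p} X` for a finitely generated torsion `Λ`-module with `μ(X) = 0` -/

section Lambda

variable (p : ℕ) [hp : Fact p.Prime] (X : Type u) [AddCommGroup X] [Module (IwasawaAlgebra p) X]

/-- The `ℤ_p`-module structure of a `Λ = ℤ_p⟦T⟧`-module by restriction of scalars along
`ℤ_p → Λ` (local instance; it is `RestrictScalars ℤ_[p] Λ X` on the nose). [folklore] -/
theorem isScalarTower_compHom :
    letI : Module ℤ_[p] X := Module.compHom X (algebraMap ℤ_[p] (IwasawaAlgebra p))
    IsScalarTower ℤ_[p] (IwasawaAlgebra p) X :=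
  IsScalarTower.of_compHom ℤ_[p] _ X

/-- **`μ(X) = 0` ⇒ `X` is finitely generated over `ℤ_p`** (for `X` finitely generated torsion over
`Λ`; Washington §13.2, tree theorem `muInvariant_eq_zero_iff_finite`), for the restricted
`ℤ_p`-structure. [folklore] -/
theorem moduleFinite_int_of_muInvariant_eq_zero [Module.Finite (IwasawaAlgebra p) X]
    (hX : Module.IsTorsion (IwasawaAlgebra p) X) (hμ : muInvariant p X = 0) :
    letI : Module ℤ_[p] X := Module.compHom X (algebraMap ℤ_[p] (IwasawaAlgebra p))
    Module.Finite ℤ_[p] X := by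
  letI : Module ℤ_[p] X := Module.compHom X (algebraMap ℤ_[p] (IwasawaAlgebra p))
  haveI : IsScalarTower ℤ_[p] (IwasawaAlgebra p) X := IsScalarTower.of_compHom ℤ_[p] _ X
  exact (muInvariant_eq_zero_iff_finite p X hX).mp hμ

/-- **`λ(X) = rank_{ℤ_p} X`**: the tree's `lambdaInvariant p X = dim_{ℚ_p}(ℚ_p ⊗_{ℤ_p} X)` is the
`ℤ_p`-rank of `X` for the restricted `ℤ_p`-structure (`ℚ_p ⊗_{ℤ_p} -` is localisation at
`ℤ_p ∖ 0`: `IsLocalizedModule.rank_eq`). Washington §13.2 (`λ = rank_{ℤ_p}` for `μ = 0`).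
[folklore] -/
theorem lambdaInvariant_eq_finrank :
    letI : Module ℤ_[p] X := Module.compHom X (algebraMap ℤ_[p] (IwasawaAlgebra p))
    lambdaInvariant p X = Module.finrank ℤ_[p] X := by
  letI : Module ℤ_[p] X := Module.compHom X (algebraMap ℤ_[p] (IwasawaAlgebra p))
  haveI : IsScalarTower ℤ_[p] (IwasawaAlgebra p) X := IsScalarTower.of_compHom ℤ_[p] _ X
  change Module.finrank ℚ_[p] (ℚ_[p] ⊗[ℤ_[p]] X) = _
  rw [Module.finrank, Module.finrank, IsLocalization.rank_eq ℚ_[p] (nonZeroDivisors ℤ_[p]) le_rfl,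
    IsLocalizedModule.rank_eq (nonZeroDivisors ℤ_[p]) le_rfl (TensorProduct.mk ℤ_[p] ℚ_[p] X 1)]

end Lambda

/-! ## §4. Assembly: `#S[p] = p ^ λ(X)` -/

section Assembly

variable (p : ℕ) [hp : Fact p.Prime] {S : Type*} [AddCommGroup S]
  (X : Type u) [AddCommGroup X] [Module (IwasawaAlgebra p) X]

/-- **`S[p]` is finite and `#S[p] = p ^ λ(X)`** for a `p`-DIVISIBLE abelian group `S` with a
Pontryagin dual `X ≅ Hom(S, ℚ/ℤ)` (as groups) that is a finitely generated torsion
`Λ = ℤ_p⟦T⟧`-module with `μ(X) = 0` — the group theory behind GV 2000 p. 8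
"`Sel^{Σ₀}_E(ℚ_∞)_p ≅ (ℚ_p/ℤ_p)^{λ^{alg}_{E,Σ₀}}` and therefore
`λ^{alg}_{E,Σ₀} = dim_{𝔽_p}(Sel^{Σ₀}_E(ℚ_∞)_p[p])`". [folklore] -/
theorem finite_and_natCard_torsionBy_eq_pow_lambdaInvariant_of_divisible
    [Module.Finite (IwasawaAlgebra p) X] (hX : Module.IsTorsion (IwasawaAlgebra p) X)
    (hμ : muInvariant p X = 0) (hdiv : ∀ s : S, ∃ t : S, p • t = s)
    (Ψ : X ≃+ CharacterModule S) :
    Finite (S[(p : ℤ)]) ∧ Nat.card (S[(p : ℤ)]) = p ^ lambdaInvariant p X := by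
  letI : Module ℤ_[p] X := Module.compHom X (algebraMap ℤ_[p] (IwasawaAlgebra p))
  haveI : IsScalarTower ℤ_[p] (IwasawaAlgebra p) X := IsScalarTower.of_compHom ℤ_[p] _ X
  haveI : Module.Finite ℤ_[p] X := moduleFinite_int_of_muInvariant_eq_zero p X hX hμ
  exact ⟨finite_torsionBy_of_addEquiv p Ψ,
    (natCard_torsionBy_eq_pow_finrank_of_divisible p hdiv Ψ).trans
      (by rw [lambdaInvariant_eq_finrank p X])⟩

/-- Corollary: under the same hypotheses `λ(X) = dim_{𝔽_p} S[p]` in the form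
`Nat.log p #S[p] = λ(X)`. [folklore] -/
theorem lambdaInvariant_eq_log_natCard_torsionBy_of_divisible
    [Module.Finite (IwasawaAlgebra p) X] (hX : Module.IsTorsion (IwasawaAlgebra p) X)
    (hμ : muInvariant p X = 0) (hdiv : ∀ s : S, ∃ t : S, p • t = s)
    (Ψ : X ≃+ CharacterModule S) :
    Nat.log p (Nat.card (S[(p : ℤ)])) = lambdaInvariant p X := by
  rw [(finite_and_natCard_torsionBy_eq_pow_lambdaInvariant_of_divisible p X hX hμ hdiv Ψ).2,
    Nat.log_pow hp.out.one_lt]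

end Assembly

end Summit.BirchSwinnertonDyer.Rank1Residual.X2.NonPrimitiveSelmerTorsionCard

end
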